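import Summits.BirchSwinnertonDyer.BirchSwinnertonDyer.Theorems.KimAtThreeDeepLowerOffStratumLevelLoweringRibetRowsFinal
import Literature.NumberTheory.EllipticCurves.HeckePolynomialSimpleRootsWeightTwo
import HarnessLib

/-!
# Route `KimAtThreeKolyvagin` (rung W2), crux `DeepLowerAtThreeOffKatoStratum` (item 19679), registered
# stub `stub_nonAdditive`, ROAD (b): the semistable depth-`1` rows for EVERY Tamagawa-`3` prime `q ≠ 3`, with
# `α ≠ β` from COLEMAN–EDIXHOVEN 1998 (cited fact) — eleven named facts, row conditions, nothing else displayed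

Cell `bsd-addord`, seat `bsd-addord-w2-acc2` (PROGRAMME PART 1b, ACCEL-LIST row (2)), gen 5; item
`stmt-BirchSwinnertonDyer-19679` (OWNER w2-c2 assembles; `--supports`, closes nothing). `…RibetRowsFinal` closed
ROAD (b) on the semistable depth-`1` rows with `q ≢ 1 (mod 3)` from ten named facts; its ★★′
`stub_nonAdditive_semistable_depthOne_of_ne` takes the decision «`α ≠ β` for the roots of `X² − a_q(g)X + q`,
`g` a level-`M` newform» as input. In weight `2` that decision is a PUBLISHED THEOREM for every `q ∤ M`:
Coleman–Edixhoven, Math. Ann. 310 (1998), Thm. 2.1 — the tree's NAMED FACT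
`Literature.NumberTheory.EllipticCurves.colemanEdixhoven1998_heckePolynomial_simpleRoots` (litref, wi-76860,
`HeckePolynomialSimpleRootsWeightTwo.lean`; reading `.root_ne`), consumed BY NAME:

★★ `stub_nonAdditive_semistable_depthOne_of_colemanEdixhoven` — the registered stub's binders VERBATIM (level
`M·q`) + `Semistable W₀` + «ordinary if good at `3`» + `v₃(∏ c_ℓ) ≤ 1` + `q` split multiplicative, `q ≠ 3`,
`q ∤ M`, `M` squarefree, `3 ∣ ord_q Δ`, `3 ∤ ord_ℓ Δ` (`ℓ ∣ M` prime, `ℓ ≠ 3`), `3 ∣ M → 3 ∤ ord_3 Δ` ⟹ the LOWER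
deep inequality of 19679, from ELEVEN NAMED FACTS (the ten of `…RibetRowsFinal` +
`colemanEdixhoven1998_heckePolynomial_simpleRoots`). Theorems only; nothing booked; BSD is not proved by any of
this.

## References

* R. F. Coleman, B. Edixhoven, *On the semi-simplicity of the `U_p`-operator on modular forms*, Math. Ann. 310
  (1998) 119–127, Thm. 2.1 (arXiv:alg-geom/9611013, §2 Thm. 1). [ColemanEdixhoven1998]
* K. A. Ribet, Invent. Math. 100 (1990), Thm. 1.1 [Ribet1990]; V. Vatsal, Duke Math. J. 98 (1999), §1 [Vatsal1999];
  K. A. Ribet, Proc. ICM 1983, Thm. 4.1 [Ribet1984ICM]; J. Tate, in Cassels–Fröhlich (1967), VII §2.4 [TateGCFT1967].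
-/

set_option autoImplicit false
-- the Theorems namespace of a single-conjunct summit repeats the summit name by design (D-0017)
set_option linter.dupNamespace false

noncomputable section

open scoped MatrixGroups ModularForm Classical NNReal

open CongruenceSubgroup WeierstrassCurve Literature.NumberTheory.EllipticCurves
  Literature.NumberTheory.EllipticCurves.ModularForms

namespace Summit.BirchSwinnertonDyer.BirchSwinnertonDyer.Theorems.KimAtThreeDeepLowerOffStratumLevelLoweringRibetRowsCE

open Summit.BirchSwinnertonDyer.BirchSwinnertonDyer.Theorems.KimAtThreeDeepLowerOffStratumLevelLoweringRibetRowsFinal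
open Literature.NumberTheory.EllipticCurves.Rank1Residual Literature.NumberTheory.EllipticCurves.Rank1Residual.Typed
  Literature.NumberTheory.EllipticCurves.Skinner2016 Literature.NumberTheory.Automorphic

/-! ### §1 ★★ The rows for every `q ≠ 3` -/

/-- ★★ **`stub_nonAdditive` (crux 19679) on its SEMISTABLE depth-`1` rows for every Tamagawa-`3` prime `q ≠ 3`,
from ELEVEN NAMED FACTS and the ROW CONDITIONS ONLY** (`α ≠ β` by `colemanEdixhoven1998_heckePolynomial_simpleRoots`,
reading `.root_ne` with `α = a_q(g) − β`).
[cite: ColemanEdixhoven1998, Thm. 2.1] [cite: Ribet1990, Thm. 1.1] [cite: Diamond1995RefinedSerre, Thm. 6.4 and Cor. 6.5]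
[cite: Vatsal1999, §1 (1.6), Thm. (1.13)] [cite: GreenbergVatsal2000, §3 (17)–(19)] [cite: Ribet1984ICM, Thm. 4.1]
[cite: TateGCFT1967, §2.4 (Tchebotarev density theorem) with Prop. 2.3] [cite: Skinner2016PacificMC, Thm. C (§1)]
[cite: Mazur1978, Cor. 4.1] [cite: Kim2022StructureSelmer, Conj. 1.10 (PDF p. 8)] -/
theorem stub_nonAdditive_semistable_depthOne_of_colemanEdixhoven
    (hCE : colemanEdixhoven1998_heckePolynomial_simpleRoots)
    (hR : ribet1990_levelLowering_gamma0_newform_at_three)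
    (hV : vatsal1999_plusSymbol_congruence) (hGV : greenbergVatsal2000_plusSymbol_congruence)
    (hI : ribet1984_iharaLemma)
    (hSk : Skinner2016.thmC_padicValRat_bsd_rank_zero)
    (hmod : hasEntireLFunction_rat) (hGZK : rank_eq_analyticRank_of_analyticRank_le_one)
    (hM : mazur_not_dvd_maninConstant_of_odd)
    (hBCDT : exists_isNewformOf) (hLL' : diamond1995_refinedSerre) :
    ∀ (W₀ : WeierstrassCurve ℚ) [W₀.IsElliptic] [W₀.IsGloballyMinimal],
      (∀ n : ℕ, W₀.HasSurjectiveModNGaloisRep (3 ^ n : ℕ)) → Finite W₀.sha →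
      ∀ {M q : ℕ} [NeZero M] [NeZero q] [Fact q.Prime] [NeZero (M * q)], M * q = W₀.conductorNorm ℤ →
      ∀ (D₀ : ModularParametrizationData W₀ (M * q)),
        (∀ z ∈ D₀.L.lattice, ∃ w ∈ periodLattice D₀.f, z = D₀.c * w) →
        (∀ (W₂ : WeierstrassCurve ℚ) [W₂.IsElliptic] (D₂ : ModularParametrizationData W₂ (M * q)),
          D₂.f = D₀.f → D₀.modularDegree ≤ D₂.modularDegree) →
        (∀ r : ℚ, ratPlusSymbol D₀.f r ≠ 0 → 0 ≤ padicValRat 3 (ratPlusSymbol D₀.f r)) →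
        kuriharaVanishingOrder W₀ 3 D₀.f = 0 →
        ¬ (haveI : Fact (Nat.Prime 3) := ⟨Nat.prime_three⟩; Addv W₀ 3) →
        Semistable W₀ →
        (W₀.HasGoodReductionAtPrime 3 → ¬ (3 : ℤ) ∣ W₀.frobeniusTrace 3) →
        padicValNat 3 W₀.tamagawaProduct ≤ 1 →
        W₀.HasSplitMultiplicativeReductionAtPrime q →
        q ≠ 3 → ¬ q ∣ M → Squarefree M → (3 : ℤ) ∣ padicValRat q W₀.Δ →
        (∀ ℓ : ℕ, ℓ.Prime → ℓ ∣ M → ℓ ≠ 3 → ¬ (3 : ℤ) ∣ padicValRat ℓ W₀.Δ) →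
        (3 ∣ M → ¬ (3 : ℤ) ∣ padicValRat 3 W₀.Δ) →
        ∃ d : ℕ, kuriharaPartialDeepInfty W₀ 3 D₀.f = d ∧
          kuriharaPartial W₀ 3 D₀.f 0 ≤
            ((padicValNat 3 (Nat.card (AddCommGroup.primaryComponent W₀.sha 3)) + d : ℕ) : ℕ∞) := by
  intro W₀ _ _ htower hfin M q _ _ _ _ hN D₀ hopt hdeg hint hord hnA hsst hordinary hv hsplit hq3 hqM hMsq hqΔ hℓΔ h3Δ
  have hq : q.Prime := Fact.out
  set ι : PadicAlgCl 3 ≃+* ℂ := Classical.choice (PadicAlgCl.nonempty_ringEquiv_complex 3) with hι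
  exact stub_nonAdditive_semistable_depthOne_of_ne hR hV hGV hI hSk hmod hGZK hM hBCDT hLL' W₀ htower hfin hN D₀ hopt
    hdeg hint hord hnA hsst hordinary hv hsplit hq3 hqM hMsq hqΔ hℓΔ h3Δ ι
    (fun g hg _ β hβ _ ↦ colemanEdixhoven1998_heckePolynomial_simpleRoots.root_ne hCE hg hq hqM
      (sub_add_cancel _ β) (by linear_combination -hβ))

end Summit.BirchSwinnertonDyer.BirchSwinnertonDyer.Theorems.KimAtThreeDeepLowerOffStratumLevelLoweringRibetRowsCE

end
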